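import Summits.HodgeConjecture.HodgeConjecture.Theses.HCCMUnconditional
import Summits.HodgeConjecture.CorCM.HypD1pp.A4LiuD1ppHeadOfFacts
import Literature.RepresentationTheory.MoeglinVignerasWaldspurger1987.RankOneThetaLiftIrreducibleProofs
import Literature.NumberTheory.Automorphic.Liu2021.SplitPlaceOscillatorModelProofs
import Literature.NumberTheory.Automorphic.Zelevinsky1980.UnitaryCharacterInductionIrreducible
import HarnessLib

/-!
# Route `HCCMUnconditional`, crux `HD1pp` (stmt-HodgeConjecture-24838) — PROVED
# (binder `hD1''` of `hc_cm_of_printed_citations_muKey_ident_lemD3_delRecConjOmegaT`: [Liu2021, Lem. D.1, first sentence + (1)]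
# AS PRINTED, per admissible index and finite place, at the face datum)

Cell `hodgecm-mathlib` (D-0151 release track, ladder HODGECM-MATHLIB rung 0), fan A line `a4-liuD1pp` ∘ fan B line
`b4-lemD1-item1-at-v`.  The route decl `Summit.HodgeConjecture.HodgeConjecture.Theses.HCCMUnconditional.HD1pp` is by definition the
pack decl `PrintedCitationHypotheses.HypD1pp`; it is closed by the tree head `hypD1pp_of_facts`
(`Summits/HodgeConjecture/CorCM/HypD1pp/A4LiuD1ppHeadOfFacts.lean`: the six stubs of `a4-liuD1pp` by name — MVW rank-one
theta facts IV-1a `mvw_IV4_rankOne_irreducibleOrZero_holds` [MoeglinVignerasWaldspurger1987, Chap. 3 IV.4 1a)], IV-1b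
`mvw_IV4_rankOne_admissible_holds` [IV.4 2a)], IV-2 `mvw_IV2_rankOne_nonvanishing_of_isotropic_holds` [IV.2], isotropy of hermitian
spaces of rank `≥ 3` (`isotropyRankThree`), fan B's per-place composition (`lemD1Item1AtV`) and the split-place consequences
(`splitPlaceModelConsequences_of_facts`)) fed with the LAST interface fact IV-3(a), the split-place model of the rank-one theta lift
`Liu2021.splitPlace_chiCoinv_iso_parabolicIndGL` [Liu2021, proof of Lem. D.1, l. 5253; GelbartRogawski1990 §2.6], now PROVED:
`splitPlace_chiCoinv_iso_parabolicIndGL_of_isIrreducible` (`Liu2021/SplitPlaceOscillatorModelProofs.lean`) applied to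
[Zelevinsky1980, Thm 4.2] `Zelevinsky1980.parabolicIndGL_detChar_unitary_isIrreducible_holds`.

HC_CM is proved only modulo the printed citations until rung 0 closes: this file discharges the binder `hD1''` (one of the seven);
it asserts nothing else.

## References
* [Liu2021] Y. Liu, Camb. J. Math. 9 (2021) = arXiv:2102.11518, App. D Lemma D.1 (1) (l. 5246–5253), proof l. 5249–5266.
* [MoeglinVignerasWaldspurger1987] C. Mœglin, M.-F. Vignéras, J.-L. Waldspurger, LNM 1291 (1987), Chap. 3 IV.2, IV.4.
* [Zelevinsky1980] A. Zelevinsky, Ann. Sci. ÉNS 13 (1980), Thm 4.2.  [GelbartRogawski1990] S. Gelbart, J. Rogawski, §2.6.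
-/

set_option autoImplicit false

namespace Summit.HodgeConjecture.HodgeConjecture.Theorems

/-- **Crux `HD1pp` of route `HCCMUnconditional`, PROVED**: [Liu2021, Lem. D.1, first sentence + (1)] AS PRINTED at the face datum
of the HC_CM headline, per admissible index `j` and finite place `v` — the binder `hD1''` closed over `hDel`
(`PrintedCitationHypotheses.HypD1pp`).  Term: the tree head `hypD1pp_of_facts` at the proved IV-1a `mvw_IV4_rankOne_irreducibleOrZero_holds`, the proved
split-place model (`splitPlace_chiCoinv_iso_parabolicIndGL_of_isIrreducible parabolicIndGL_detChar_unitary_isIrreducible_holds`)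
and the proved IV-3(b) (equivalently `hypD1pp_of_splitPlaceModel`, `A4LiuD1ppHeadOfSplitPlaceModel.lean`).
[cite: Liu2021, App. D Lem. D.1 (1) (l. 5246–5253)] [cite: MoeglinVignerasWaldspurger1987, Chap. 3 IV.2, IV.4]
[cite: Zelevinsky1980, Thm. 4.2] [cite: GelbartRogawski1990, §2.6] -/
theorem HD1pp_proof : Summit.HodgeConjecture.HodgeConjecture.Theses.HCCMUnconditional.HD1pp := by
  unfold Summit.HodgeConjecture.HodgeConjecture.Theses.HCCMUnconditional.HD1pp
  exact Summit.HodgeConjecture.CorCM.HypD1pp.hypD1pp_of_facts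
    Literature.RepresentationTheory.MoeglinVignerasWaldspurger1987.mvw_IV4_rankOne_irreducibleOrZero_holds
    (Literature.NumberTheory.Automorphic.Liu2021.splitPlace_chiCoinv_iso_parabolicIndGL_of_isIrreducible
      Literature.NumberTheory.Automorphic.Zelevinsky1980.parabolicIndGL_detChar_unitary_isIrreducible_holds.{0})
    Literature.NumberTheory.Automorphic.Zelevinsky1980.parabolicIndGL_detChar_unitary_isIrreducible_holds.{0}

end Summit.HodgeConjecture.HodgeConjecture.Theorems
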